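import Literature.NumberTheory.Rogawski1990.ArchSingularMembersOfFrame             -- ★ p843796 (W4d): the assembly re-run here, and every brick it imports (END ★ p843392, W1-ref ★ p843612, W3-pins ★ p843599, ★ p842955, (T-d) FILE 1)
import Literature.NumberTheory.Rogawski1990.ArchSingularWitnessFamilyPullback          -- ★ p843944 (W4c′): `exists_archSingularFamily_of_coherent_torusDatum_pullback`, `exists_conj_archDiagTorus_eq_archCongr_of_not_central`
import Literature.NumberTheory.Rogawski1990.ArchSingularPinTopFormUniversal            -- ★ p843836 (U): the hypothesis of record (binder `hU`), ★ p843734 (J-val-K) plumbing behind it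
import Literature.NumberTheory.Weil1964.UnitaryArchSingularCentralizerTopFormHaarCongr -- ★ p843845 (b0): `map_archCongr_centralizerTopFormHaar`, `exists_isSingularArchFrame_archCongr`
import Literature.NumberTheory.Weil1964.UnitaryArchSingularTopFormFamilyQuotient      -- ★ `exists_atPoint_archSingularTopFormFamily_eq`
import HarnessLib

/-!
# (W4f) THE ARCHIMEDEAN HALF OF S1′ WITH (J-val-K) FOR THE BUILT WITNESS: under the universal pin ratio (U) the exported torus datum of ★ (W4d) IS `K⁻¹ ×` the top-form
# centraliser measure at every framed guard point off the centre, and the built singular members are `K ×` the top-form members there (Rogawski 1990 §1.7, §4.3, §8.2, §14.5)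

Topic `NumberTheory/Rogawski1990`; namespace `Literature.NumberTheory.Rogawski1990`.  THEOREMS ONLY (no `def`, no instance, no notation, no axiom, no named fact, no `sorry`).
Cell `pub/hodgecm-mathlib`, ENGINE T1 (crux H413 = `stmt-HodgeConjecture-24833`); the (ST-∞) witness road, brick (W4f) «(U)+(b0) ⟹ (J-val-K) for the built datum» (F0P3-p03 (g11);
SPEC `F0/P3a/F0P3a-p07/g9/SPEC-W4f-U-sibling.F0P3ap07g9.md` c53fc94cf2dc0bf6, route (4a); LEAD F0P3a-plan (g10) WORD T9-22 (3): «(W4d) derives `hK` inside and EXPORTS the (W-a) conjunct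
for the D-T (K7-s) assembly»).  Count-neutral; HONEST LABEL: HC_CM is proved only modulo the printed citations until rung 0 closes; (U) stays a NAMED HYPOTHESIS here (its discharge is
the D-T road's per-place top-form factors), and the finite-place conjuncts of S1′ are not touched.

WHAT.  **`exists_archSingularMembers_withData_of_universal_pinRatio`** = ★ (W4d) `exists_archSingularMembers_withData` with three more binders — the reference wall `z₁` (normal form
`z₁_w 0 = z₁_w 2 ≠ z₁_w 1`) and its quotient σ-algebras, a constant `K ≠ 0`, and **(U)** = the binder `hU` of ★ `smul_centralizerTopFormHaar_of_universal_pinRatio` VERBATIM at the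
carrier `α′` of `H′` — and two more conjuncts about THE SAME families `mGis`, `TsG`:
* **(J-val-K-built)** for every `x ∈ G′_∞ = U(H′)(L ⊗ ℝ)` in the S1′ guard («`∃ γ₀ ∈ U(H′)(L⁺)` non-regular, `γ₀ ⊗ 1 ↔ x`») that is NOT a rational scalar `ζ ⊗ 1` and is FRAMED
  (★ `IsSingularArchFrame`; the rational points `γ₀ ⊗ 1` are, ★ `exists_isSingularArchFrame_cmRationalToArch`): `TsG x = K⁻¹ • centralizerTopFormHaar L H′ x` — ★ p843734's `hK`
  with ONE constant for all such points;
* **(W-a)** at the same points: `mGis.atPoint x = K • dν′ ∕ d(centralizerTopFormHaar L H′ x) = K • (archSingularTopFormFamily L H′ ν′).atPoint x` — the built singular member IS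
  `K ×` the top-form member (★ A-p19 `exists_atPoint_archSingularTopFormFamily_eq`): (K7-s) for the built witness ⟺ (K7-s) for the D-T top-form witness.
PROOF = ★ (W4d)'s, the carrier-`α′` witness taken from ★ (W4c′) (datum = `Ψ`-pull-back of the one-stop datum `T` on `Pall`); then at a guard point `x` off the centre: ★ (W4c′) guard
lemma `Ψ x = q·t(zw∘ρ)·q⁻¹` with `zw` of rational type; frames at `Ψ x` (★ (b0)) and `t(zw∘ρ)` (★ conj); (U) + one-stop `T (t(zw∘ρ)) = ρ′` ⟹ `T (t(zw∘ρ)) = K⁻¹ • centralizerTopFormHaar`;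
carried to `Ψ x` by the one-stop's coherence + ★ `map_subgroupCongrHomeomorph_conj_centralizerTopFormHaar`, and to `x` by (PULL) + ★ (b0) `map_archCongr_centralizerTopFormHaar`
(`Ψ⁻¹| ∘ Ψ| = id`).  (W-a): ★ p843734 §1 on the conjugation-stable framed guard (coherence of `TsG` there = coherence of `centralizerTopFormHaar`).

## References
* [Rogawski1990] J. D. Rogawski, *Automorphic Representations of Unitary Groups in Three Variables*, Ann. of Math. Stud. 123 (1990), §1.7 p. 6; §3.8 Prop. 3.8.1 (a) p. 27; §4.3 (4.3.1)
  p. 43; §8.2 pp. 117–124; Prop. 10.1.2 (b) p. 146; §14.2 (14.2.1) p. 232; §14.5 Lemma 14.5.2 (b) pp. 238–239.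
* [Kottwitz1988] R. E. Kottwitz, *Tamagawa numbers*, Ann. of Math. 127 (1988), Prop. 2.
* [DeitmarEchterhoff2014] A. Deitmar, S. Echterhoff, *Principles of Harmonic Analysis*, 2nd ed. (2014), Thm. 1.5.3.
* [Landherr1936HermitianForms] W. Landherr, *Äquivalenz Hermitescher Formen über einem beliebigen algebraischen Zahlkörper*, Abh. Math. Sem. Hamburg 11 (1936).
-/

set_option autoImplicit false

noncomputable section

open MeasureTheory Measure Filter Topology NumberField NumberField.InfinitePlace NumberField.mixedEmbedding Equiv Function Set
open Literature.MeasureTheory.Group Literature.NumberTheory.Automorphic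
open Literature.NumberTheory.Automorphic.UnitaryGroup hiding hermForm
open Literature.AlgebraicGeometry.ShimuraVarieties (unitaryGroup hermForm)
open Literature.LinearAlgebra.Matrix
open Literature.NumberTheory.Weil1964 Literature.NumberTheory.Weil1964.UnitaryArchTopForm
open scoped Matrix MatrixGroups Matrix.Norms.Operator ContDiff NNReal ENNReal

namespace Literature.NumberTheory.Rogawski1990

variable (L : Type) [Field L] [NumberField L] [IsCMField L] (H' : Matrix (Fin 3) (Fin 3) L)
  [iGL : MeasurableSpace (GL (Fin 3) ℂ)] [iGLb : BorelSpace (GL (Fin 3) ℂ)]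
  [iAH : MeasurableSpace (arch (↥(maximalRealSubfield L)) L (IsCMField.complexConj L) 3 H')] [iAHb : BorelSpace (arch (↥(maximalRealSubfield L)) L (IsCMField.complexConj L) 3 H')]
  [iAG : MeasurableSpace (arch (↥(maximalRealSubfield L)) L (IsCMField.complexConj L) 3 (Matrix.of fun i j : Fin 3 => if i.val + j.val + 1 = 3 then (1 : L) else 0))]
  [iAGb : BorelSpace (arch (↥(maximalRealSubfield L)) L (IsCMField.complexConj L) 3 (Matrix.of fun i j : Fin 3 => if i.val + j.val + 1 = 3 then (1 : L) else 0))]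
  [iQH : ∀ γ' : arch (↥(maximalRealSubfield L)) L (IsCMField.complexConj L) 3 H', MeasurableSpace (arch (↥(maximalRealSubfield L)) L (IsCMField.complexConj L) 3 H' ⧸ Subgroup.centralizer ({γ'} : Set _))]
  [iQHb : ∀ γ' : arch (↥(maximalRealSubfield L)) L (IsCMField.complexConj L) 3 H', BorelSpace (arch (↥(maximalRealSubfield L)) L (IsCMField.complexConj L) 3 H' ⧸ Subgroup.centralizer ({γ'} : Set _))]
  [iQG : ∀ γ' : arch (↥(maximalRealSubfield L)) L (IsCMField.complexConj L) 3 (Matrix.of fun i j : Fin 3 => if i.val + j.val + 1 = 3 then (1 : L) else 0),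
    MeasurableSpace (arch (↥(maximalRealSubfield L)) L (IsCMField.complexConj L) 3 (Matrix.of fun i j : Fin 3 => if i.val + j.val + 1 = 3 then (1 : L) else 0) ⧸ Subgroup.centralizer ({γ'} : Set _))]
  [iQGb : ∀ γ' : arch (↥(maximalRealSubfield L)) L (IsCMField.complexConj L) 3 (Matrix.of fun i j : Fin 3 => if i.val + j.val + 1 = 3 then (1 : L) else 0),
    BorelSpace (arch (↥(maximalRealSubfield L)) L (IsCMField.complexConj L) 3 (Matrix.of fun i j : Fin 3 => if i.val + j.val + 1 = 3 then (1 : L) else 0) ⧸ Subgroup.centralizer ({γ'} : Set _))]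

set_option maxHeartbeats 1600000 in
open scoped Classical in
/-- **(W4f) THE ARCHIMEDEAN HALF OF S1′ ASSEMBLED, WITH (J-val-K) FOR THE BUILT WITNESS UNDER (U).**  ★ (W4d) `exists_archSingularMembers_withData` — singular families `mGis`, `mqis`
WITH THEIR TORUS DATA `TsG`, `Tsq` and (Q-∞), (Q-q∞), (INV′)(INV), the archimedean half of (C1), (C1-q), (ST-∞-s) token for token — from the frame's regular Weil data, PLUS: under the
universal pin ratio (U) (binder `hU`, ★ `smul_centralizerTopFormHaar_of_universal_pinRatio`'s VERBATIM at the carrier `α′`, constant `K ≠ 0`, reference wall `z₁`),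
(J-val-K-built) `TsG x = K⁻¹ • centralizerTopFormHaar L H′ x` and (W-a) `mGis.atPoint x = K • dν′∕d(centralizerTopFormHaar L H′ x) = K • (archSingularTopFormFamily L H′ ν′).atPoint x`
at every FRAMED point `x` of the S1′ guard that is not a rational scalar.
[cite: Rogawski1990, §1.7 p. 6; §3.8 Prop. 3.8.1 (a) p. 27; §4.3 (4.3.1) p. 43; §8.2 pp. 119–124; Prop. 10.1.2 (b) p. 146; §14.2 (14.2.1) p. 232; §14.5 Lemma 14.5.2 (b) pp. 238–239]
[cite: Kottwitz1988, Prop. 2] [cite: DeitmarEchterhoff2014, Thm. 1.5.3] -/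
theorem exists_archSingularMembers_withData_of_universal_pinRatio
    (hherm : (H'.map (cmConjRingHom L))ᵀ = H') (hanis : ∀ x : Fin 3 → L, hermForm (cmConjRingHom L) H' x x = 0 → x = 0)
    -- rational diagonal frames
    (α' : Fin 3 → L) (P : GL (Fin 3) L) (hP : formCongr (cmConjRingHom L) P (Matrix.diagonal α') = H')
    (hα' : ∀ i, α' i ≠ 0) (hhermα : ∀ i, (IsCMField.complexConj L (α' i) : L) = α' i)
    [iAA : MeasurableSpace (arch (↥(maximalRealSubfield L)) L (IsCMField.complexConj L) 3 (Matrix.diagonal α'))] [iAAb : BorelSpace (arch (↥(maximalRealSubfield L)) L (IsCMField.complexConj L) 3 (Matrix.diagonal α'))]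
    -- the reference wall `z₁_w = (ζ, ζ′, ζ)` the universal pin ratio (U) is stated at, the quotient σ-algebras it reads, its constant `K`, and (U) ITSELF (★ p843836's binder `hU` VERBATIM at `α′`)
    (z₁ : {w : InfinitePlace L // IsComplex w} → Fin 3 → Circle) (h02 : ∀ w, z₁ w 0 = z₁ w 2) (h01 : ∀ w, z₁ w 0 ≠ z₁ w 1)
    [iRA : ∀ (w : {w : InfinitePlace L // IsComplex w}) (τ : Perm (Fin 3)), MeasurableSpace (archLocal L 3 (Matrix.diagonal (α' ∘ ⇑τ)) w ⧸ Subgroup.centralizer ({(⟨circleDiagonal 3 (z₁ w), circleDiagonal_mem_archLocal_diagonal L 3 (α' ∘ ⇑τ) w (z₁ w)⟩ : archLocal L 3 (Matrix.diagonal (α' ∘ ⇑τ)) w)} : Set (archLocal L 3 (Matrix.diagonal (α' ∘ ⇑τ)) w)))]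
    [iRAb : ∀ (w : {w : InfinitePlace L // IsComplex w}) (τ : Perm (Fin 3)), BorelSpace (archLocal L 3 (Matrix.diagonal (α' ∘ ⇑τ)) w ⧸ Subgroup.centralizer ({(⟨circleDiagonal 3 (z₁ w), circleDiagonal_mem_archLocal_diagonal L 3 (α' ∘ ⇑τ) w (z₁ w)⟩ : archLocal L 3 (Matrix.diagonal (α' ∘ ⇑τ)) w)} : Set (archLocal L 3 (Matrix.diagonal (α' ∘ ⇑τ)) w)))]
    (K : ℝ≥0) (hK : K ≠ 0)
    (hU : ∀ (νH : ∀ (w : {w : InfinitePlace L // IsComplex w}) (τ : Perm (Fin 3)), Measure (Subgroup.centralizer ({(⟨circleDiagonal 3 (z₁ w), circleDiagonal_mem_archLocal_diagonal L 3 (α' ∘ ⇑τ) w (z₁ w)⟩ : archLocal L 3 (Matrix.diagonal (α' ∘ ⇑τ)) w)} : Set (archLocal L 3 (Matrix.diagonal (α' ∘ ⇑τ)) w))))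
        (hνH : ∀ w τ, (νH w τ).IsHaarMeasure ∧ (νH w τ).IsInvInvariant)
        (hpin : ∀ (w : {w : InfinitePlace L // IsComplex w}) (τ : Perm (Fin 3)), (w.1.embedding (α' (τ 0))).re * (w.1.embedding (α' (τ 2))).re < 0 →
        haveI : LocallyCompactSpace (archLocal L 3 (Matrix.diagonal (α' ∘ ⇑τ)) w) := locallyCompactSpace_archLocal L 3 (Matrix.diagonal (α' ∘ ⇑τ)) w
        haveI : SecondCountableTopology (archLocal L 3 (Matrix.diagonal (α' ∘ ⇑τ)) w) := secondCountableTopology_archLocal L 3 (Matrix.diagonal (α' ∘ ⇑τ)) w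
        haveI : (νH w τ).IsHaarMeasure := (hνH w τ).1
        haveI : (νH w τ).IsInvInvariant := (hνH w τ).2
        ∃ (ν : Measure (archLocal L 3 (Matrix.diagonal (α' ∘ ⇑τ)) w)) (_ : ν.IsHaarMeasure) (_ : ν.IsMulRightInvariant),
          ∀ (Θ : Matrix (Fin 3) (Fin 3) ℂ → ℂ), ContDiff ℝ (⊤ : ℕ∞) Θ →
            HasCompactSupport (fun k : archLocal L 3 (Matrix.diagonal (α' ∘ ⇑τ)) w => Θ ((k : GL (Fin 3) ℂ) : Matrix (Fin 3) (Fin 3) ℂ)) →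
            ∀ (z₀ : Fin 3 → Circle) (h02' : z₀ 0 = z₀ 2) (h01' : z₀ 0 ≠ z₀ 1),
              Tendsto (fun ψ : ℝ => deriv (fun ψ : ℝ => (2 * Real.sin ψ : ℂ) *
                  ∫ g, Θ (((g * ⟨circleDiagonal 3 (fun i => z₀ i * Circle.exp (![(1 : ℝ), 0, -1] i * ψ)),
                    circleDiagonal_mem_archLocal_diagonal L 3 (α' ∘ ⇑τ) w _⟩ * g⁻¹ : archLocal L 3 (Matrix.diagonal (α' ∘ ⇑τ)) w) : GL (Fin 3) ℂ) : Matrix (Fin 3) (Fin 3) ℂ) ∂(ν)) ψ)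
                (𝓝[≠] 0)
                (𝓝 ((-1 : ℂ) * ∫ y, descConj (⟨circleDiagonal 3 z₀, circleDiagonal_mem_archLocal_diagonal L 3 (α' ∘ ⇑τ) w z₀⟩ : archLocal L 3 (Matrix.diagonal (α' ∘ ⇑τ)) w)
                  (Subgroup.centralizer ({(⟨circleDiagonal 3 (z₁ w), circleDiagonal_mem_archLocal_diagonal L 3 (α' ∘ ⇑τ) w (z₁ w)⟩ : archLocal L 3 (Matrix.diagonal (α' ∘ ⇑τ)) w)} : Set (archLocal L 3 (Matrix.diagonal (α' ∘ ⇑τ)) w)))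
                  (forall_mem_centralizer_circleDiagonal_comm_of_wall L (α' ∘ ⇑τ) w (h02 w) (h01 w) h02' h01')
                  (fun k : archLocal L 3 (Matrix.diagonal (α' ∘ ⇑τ)) w => Θ ((k : GL (Fin 3) ℂ) : Matrix (Fin 3) (Fin 3) ℂ)) y
                  ∂(quotientMeasure _ (νH w τ) (isClosed_coe_centralizer_singleton _) (ν)))))
        (z : {w : InfinitePlace L // IsComplex w} → Fin 3 → Circle) (hwall : ∀ w, z w 0 = z w 2 ∧ z w 0 ≠ z w 1)
        (_hrat : ∃ a b : L, ∀ w : {w : InfinitePlace L // IsComplex w}, ((z w 0 : ℂ) = w.1.embedding a) ∧ ((z w 1 : ℂ) = w.1.embedding b))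
        (ρ : {w : InfinitePlace L // IsComplex w} → Perm (Fin 3))
        (ρZ : ∀ (w : {w : InfinitePlace L // IsComplex w}) (σ : Perm (Fin 3)), Measure (Subgroup.centralizer ({(⟨circleDiagonal 3 (z w ∘ ⇑σ), circleDiagonal_mem_archLocal_diagonal L 3 α' w (z w ∘ ⇑σ)⟩ : archLocal L 3 (Matrix.diagonal α') w)} : Set (archLocal L 3 (Matrix.diagonal α') w))))
        (_hρZi : ∀ w σ, (ρZ w σ).IsHaarMeasure ∧ (ρZ w σ).IsInvInvariant)
        (_hρZ : ∀ (w : {w : InfinitePlace L // IsComplex w}) (σ : Perm (Fin 3)), ¬ 0 < (w.1.embedding (α' (σ⁻¹ 0))).re * (w.1.embedding (α' (σ⁻¹ 2))).re →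
          ρZ w σ = (νH w σ⁻¹).map (subgroupCongrHomeomorph (ContinuousMulEquiv.restrictSubgroup (GLn.conjEquiv (Matrix.GeneralLinearGroup.mkOfDetNeZero _ (det_monomial_one_ne_zero 3 σ⁻¹))) (archLocal L 3 (Matrix.diagonal (α' ∘ ⇑σ⁻¹)) w) (archLocal L 3 (Matrix.diagonal α') w) (mem_archLocal_comp_perm_iff_conj_mem L 3 α' w σ⁻¹)).toMulEquiv
        (Subgroup.centralizer ({(⟨circleDiagonal 3 (z₁ w), circleDiagonal_mem_archLocal_diagonal L 3 (α' ∘ ⇑σ⁻¹) w (z₁ w)⟩ : archLocal L 3 (Matrix.diagonal (α' ∘ ⇑σ⁻¹)) w)} : Set (archLocal L 3 (Matrix.diagonal (α' ∘ ⇑σ⁻¹)) w)))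
        (Subgroup.centralizer ({(⟨circleDiagonal 3 (z w ∘ ⇑σ), circleDiagonal_mem_archLocal_diagonal L 3 α' w (z w ∘ ⇑σ)⟩ : archLocal L 3 (Matrix.diagonal α') w)} : Set (archLocal L 3 (Matrix.diagonal α') w)))
        (relabel_inv_mem_centralizer_circleDiagonal_comp_iff L α' w σ (h02 w) (h01 w) (hwall w).1 (hwall w).2)
        (ContinuousMulEquiv.restrictSubgroup (GLn.conjEquiv (Matrix.GeneralLinearGroup.mkOfDetNeZero _ (det_monomial_one_ne_zero 3 σ⁻¹))) (archLocal L 3 (Matrix.diagonal (α' ∘ ⇑σ⁻¹)) w) (archLocal L 3 (Matrix.diagonal α') w) (mem_archLocal_comp_perm_iff_conj_mem L 3 α' w σ⁻¹)).continuous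
        (ContinuousMulEquiv.restrictSubgroup (GLn.conjEquiv (Matrix.GeneralLinearGroup.mkOfDetNeZero _ (det_monomial_one_ne_zero 3 σ⁻¹))) (archLocal L 3 (Matrix.diagonal (α' ∘ ⇑σ⁻¹)) w) (archLocal L 3 (Matrix.diagonal α') w) (mem_archLocal_comp_perm_iff_conj_mem L 3 α' w σ⁻¹)).symm.continuous))
        (_hρZ1 : ∀ (w : {w : InfinitePlace L // IsComplex w}) (σ : Perm (Fin 3)), 0 < (w.1.embedding (α' (σ⁻¹ 0))).re * (w.1.embedding (α' (σ⁻¹ 2))).re → ρZ w σ Set.univ = 1)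
        (ρP : Measure (Subgroup.pi Set.univ (fun w : {w : InfinitePlace L // IsComplex w} => Subgroup.centralizer ({(⟨circleDiagonal 3 (z w ∘ ⇑(ρ w)), circleDiagonal_mem_archLocal_diagonal L 3 α' w (z w ∘ ⇑(ρ w))⟩ : archLocal L 3 (Matrix.diagonal α') w)} : Set (archLocal L 3 (Matrix.diagonal α') w)))))
        (_hρP : Measure.map (subgroupPiCoords fun w : {w : InfinitePlace L // IsComplex w} => Subgroup.centralizer ({(⟨circleDiagonal 3 (z w ∘ ⇑(ρ w)), circleDiagonal_mem_archLocal_diagonal L 3 α' w (z w ∘ ⇑(ρ w))⟩ : archLocal L 3 (Matrix.diagonal α') w)} : Set (archLocal L 3 (Matrix.diagonal α') w))) ρP = Measure.pi fun w => ρZ w (ρ w))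
        (ρ' : Measure (Subgroup.centralizer ({archDiagTorus L 3 α' (fun w => z w ∘ ⇑(ρ w))} : Set (arch (↥(maximalRealSubfield L)) L (IsCMField.complexConj L) 3 (Matrix.diagonal α')))))
        (_hρ' : ρ' = ρP.map (subgroupCongrHomeomorph (archPiEquivCM 3 L (Matrix.diagonal α')).symm.toMulEquiv (Subgroup.pi Set.univ (fun w : {w : InfinitePlace L // IsComplex w} => Subgroup.centralizer ({(⟨circleDiagonal 3 (z w ∘ ⇑(ρ w)), circleDiagonal_mem_archLocal_diagonal L 3 α' w (z w ∘ ⇑(ρ w))⟩ : archLocal L 3 (Matrix.diagonal α') w)} : Set (archLocal L 3 (Matrix.diagonal α') w)))) (Subgroup.centralizer ({archDiagTorus L 3 α' (fun w => z w ∘ ⇑(ρ w))} : Set (arch (↥(maximalRealSubfield L)) L (IsCMField.complexConj L) 3 (Matrix.diagonal α')))) (apply_mem_centralizer_iff_mem_pi_centralizer _ (archPiEquivCM 3 L (Matrix.diagonal α')).symm.toMulEquiv (archPiEquivCM_symm_circleDiagonal_eq_archDiagTorus L 3 α' (fun w => z w ∘ ⇑(ρ w)))) (archPiEquivCM 3 L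 (Matrix.diagonal α')).symm.continuous (archPiEquivCM 3 L (Matrix.diagonal α')).continuous)),
        centralizerTopFormHaar L (Matrix.diagonal α') (archDiagTorus L 3 α' (fun w => z w ∘ ⇑(ρ w))) = K • ρ')
    (β : Fin 3 → L) (Q : GL (Fin 3) L) (hQ : formCongr (cmConjRingHom L) Q (Matrix.diagonal β) = (Matrix.of fun i j : Fin 3 => if i.val + j.val + 1 = 3 then (1 : L) else 0))
    (hβ : ∀ i, β i ≠ 0) (hhermβ : ∀ i, (IsCMField.complexConj L (β i) : L) = β i)
    -- the REGULAR archimedean data of the frame in Weil form: (W′)(W)(C)(C′G)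
    (ν' : Measure (arch (↥(maximalRealSubfield L)) L (IsCMField.complexConj L) 3 H')) (ν : Measure (arch (↥(maximalRealSubfield L)) L (IsCMField.complexConj L) 3 (Matrix.of fun i j : Fin 3 => if i.val + j.val + 1 = 3 then (1 : L) else 0)))
    [ν'.IsHaarMeasure] [ν'.IsMulRightInvariant] [ν.IsHaarMeasure] [ν.IsMulRightInvariant]
    (t' : ∀ γ' : arch (↥(maximalRealSubfield L)) L (IsCMField.complexConj L) 3 H', Measure (Subgroup.centralizer ({γ'} : Set (arch (↥(maximalRealSubfield L)) L (IsCMField.complexConj L) 3 H'))))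
    (t : ∀ γ : arch (↥(maximalRealSubfield L)) L (IsCMField.complexConj L) 3 (Matrix.of fun i j : Fin 3 => if i.val + j.val + 1 = 3 then (1 : L) else 0), Measure (Subgroup.centralizer ({γ} : Set (arch (↥(maximalRealSubfield L)) L (IsCMField.complexConj L) 3 (Matrix.of fun i j : Fin 3 => if i.val + j.val + 1 = 3 then (1 : L) else 0)))))
    (hd' : H'.det ≠ 0) (hd₃ : (Matrix.of fun i j : Fin 3 => if i.val + j.val + 1 = 3 then (1 : L) else 0).det ≠ 0)
    (hC : ∀ (γ₁ γ₂ : arch (↥(maximalRealSubfield L)) L (IsCMField.complexConj L) 3 (Matrix.of fun i j : Fin 3 => if i.val + j.val + 1 = 3 then (1 : L) else 0)) (h₁ : IsRegularElt (γ₁.val : GL (Fin 3) (mixedEmbedding.mixedSpace L)))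
      (hc : Corresponds (conjMixed (↥(maximalRealSubfield L)) L (IsCMField.complexConj L)) (archFormOf L 3 (Matrix.of fun i j : Fin 3 => if i.val + j.val + 1 = 3 then (1 : L) else 0)) (archFormOf L 3 (Matrix.of fun i j : Fin 3 => if i.val + j.val + 1 = 3 then (1 : L) else 0)) γ₁ γ₂),
      Measure.map ⇑(archStableCentralizerEquiv L hd₃ hd₃ hc h₁) (t γ₁) = t γ₂)
    (hC'G : ∀ (γ' : arch (↥(maximalRealSubfield L)) L (IsCMField.complexConj L) 3 H') (γ : arch (↥(maximalRealSubfield L)) L (IsCMField.complexConj L) 3 (Matrix.of fun i j : Fin 3 => if i.val + j.val + 1 = 3 then (1 : L) else 0)) (h' : IsRegularElt (γ'.val : GL (Fin 3) (mixedEmbedding.mixedSpace L)))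
      (hc : Corresponds (conjMixed (↥(maximalRealSubfield L)) L (IsCMField.complexConj L)) (archFormOf L 3 H') (archFormOf L 3 (Matrix.of fun i j : Fin 3 => if i.val + j.val + 1 = 3 then (1 : L) else 0)) γ' γ),
      Measure.map ⇑(archStableCentralizerEquiv L hd' hd₃ hc h') (t' γ') = t γ)
    (m' : OrbitalMeasureFamily (arch (↥(maximalRealSubfield L)) L (IsCMField.complexConj L) 3 H')) (m : OrbitalMeasureFamily (arch (↥(maximalRealSubfield L)) L (IsCMField.complexConj L) 3 (Matrix.of fun i j : Fin 3 => if i.val + j.val + 1 = 3 then (1 : L) else 0)))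
    (hW' : m'.IsQuotientOf (fun γ => IsRegularElt (γ.val : GL (Fin 3) (mixedEmbedding.mixedSpace L))) ν' t')
    (hW : m.IsQuotientOf (fun γ => IsRegularElt (γ.val : GL (Fin 3) (mixedEmbedding.mixedSpace L))) ν t) :
    ∃ (mGis : OrbitalMeasureFamily (arch (↥(maximalRealSubfield L)) L (IsCMField.complexConj L) 3 H')) (mqis : OrbitalMeasureFamily (arch (↥(maximalRealSubfield L)) L (IsCMField.complexConj L) 3 (Matrix.of fun i j : Fin 3 => if i.val + j.val + 1 = 3 then (1 : L) else 0)))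
      (TsG : ∀ γ : arch (↥(maximalRealSubfield L)) L (IsCMField.complexConj L) 3 H', Measure ↥(Subgroup.centralizer ({γ} : Set (arch (↥(maximalRealSubfield L)) L (IsCMField.complexConj L) 3 H'))))
      (Tsq : ∀ γ : arch (↥(maximalRealSubfield L)) L (IsCMField.complexConj L) 3 (Matrix.of fun i j : Fin 3 => if i.val + j.val + 1 = 3 then (1 : L) else 0), Measure ↥(Subgroup.centralizer ({γ} : Set (arch (↥(maximalRealSubfield L)) L (IsCMField.complexConj L) 3 (Matrix.of fun i j : Fin 3 => if i.val + j.val + 1 = 3 then (1 : L) else 0))))),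
      -- (W′-s)(W-s): Weil form w.r.t. the frame's OWN `ν′`, `ν`, torus data EXPORTED (so that (J-val-K)'s `hK` can be stated about THIS datum)
      mGis.IsQuotientOf (fun x : arch (↥(maximalRealSubfield L)) L (IsCMField.complexConj L) 3 H' => ∃ γ₀ : (cmDatum L 3 H').Rational, ¬ IsRegularElt (γ₀.val : GL (Fin 3) L) ∧
          Corresponds (conjMixed (↥(maximalRealSubfield L)) L (IsCMField.complexConj L)) (archFormOf L 3 H') (archFormOf L 3 H') (cmRationalToArch L 3 H' γ₀) x) ν' TsG ∧
      mqis.IsQuotientOf (fun x : arch (↥(maximalRealSubfield L)) L (IsCMField.complexConj L) 3 (Matrix.of fun i j : Fin 3 => if i.val + j.val + 1 = 3 then (1 : L) else 0) => ∃ γ₀ : (cmDatum L 3 H').Rational, ¬ IsRegularElt (γ₀.val : GL (Fin 3) L) ∧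
          Corresponds (conjMixed (↥(maximalRealSubfield L)) L (IsCMField.complexConj L)) (archFormOf L 3 H') (archFormOf L 3 (Matrix.of fun i j : Fin 3 => if i.val + j.val + 1 = 3 then (1 : L) else 0)) (cmRationalToArch L 3 H' γ₀) x) ν Tsq ∧
      -- (INV′)(INV): every member is invariant under conjugation
      (∀ q : ConjClasses (arch (↥(maximalRealSubfield L)) L (IsCMField.complexConj L) 3 H'),
        SMulInvariantMeasure (arch (↥(maximalRealSubfield L)) L (IsCMField.complexConj L) 3 H') (arch (↥(maximalRealSubfield L)) L (IsCMField.complexConj L) 3 H' ⧸ Subgroup.centralizer ({(Quotient.out q : arch (↥(maximalRealSubfield L)) L (IsCMField.complexConj L) 3 H')} : Set _)) (mGis q)) ∧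
      (∀ q : ConjClasses (arch (↥(maximalRealSubfield L)) L (IsCMField.complexConj L) 3 (Matrix.of fun i j : Fin 3 => if i.val + j.val + 1 = 3 then (1 : L) else 0)),
        SMulInvariantMeasure (arch (↥(maximalRealSubfield L)) L (IsCMField.complexConj L) 3 (Matrix.of fun i j : Fin 3 => if i.val + j.val + 1 = 3 then (1 : L) else 0))
          (arch (↥(maximalRealSubfield L)) L (IsCMField.complexConj L) 3 (Matrix.of fun i j : Fin 3 => if i.val + j.val + 1 = 3 then (1 : L) else 0) ⧸ Subgroup.centralizer ({(Quotient.out q : arch (↥(maximalRealSubfield L)) L (IsCMField.complexConj L) 3 (Matrix.of fun i j : Fin 3 => if i.val + j.val + 1 = 3 then (1 : L) else 0))} : Set _)) (mqis q)) ∧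
      -- (C1), archimedean half
      (∀ c : ConjClasses (cmDatum L 3 H').Rational,
        (∃ ζ : L, (((Quotient.out c).val : GL (Fin 3) L) : Matrix (Fin 3) (Fin 3) L) = ζ • (1 : Matrix (Fin 3) (Fin 3) L)) →
        mGis.atPoint (archPart (↥(maximalRealSubfield L)) L (IsCMField.complexConj L) 3 H' ((cmDatum L 3 H').toAdelic (Quotient.out c))) Set.univ = 1) ∧
      -- (C1-q)
      (∀ c : ConjClasses (cmDatum L 3 (Matrix.of fun i j : Fin 3 => if i.val + j.val + 1 = 3 then (1 : L) else 0)).Rational,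
        (∃ ζ : L, (((Quotient.out c).val : GL (Fin 3) L) : Matrix (Fin 3) (Fin 3) L) = ζ • (1 : Matrix (Fin 3) (Fin 3) L)) →
        mqis.atPoint (archPart (↥(maximalRealSubfield L)) L (IsCMField.complexConj L) 3 (Matrix.of fun i j : Fin 3 => if i.val + j.val + 1 = 3 then (1 : L) else 0) ((cmDatum L 3 (Matrix.of fun i j : Fin 3 => if i.val + j.val + 1 = 3 then (1 : L) else 0)).toAdelic (Quotient.out c))) Set.univ = 1) ∧
      -- (ST-∞-s)
      (∀ (a' : arch (↥(maximalRealSubfield L)) L (IsCMField.complexConj L) 3 H' → ℂ) (a : arch (↥(maximalRealSubfield L)) L (IsCMField.complexConj L) 3 (Matrix.of fun i j : Fin 3 => if i.val + j.val + 1 = 3 then (1 : L) else 0) → ℂ),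
        ArchSmooth L 3 H' a' → ArchSmooth L 3 (Matrix.of fun i j : Fin 3 => if i.val + j.val + 1 = 3 then (1 : L) else 0) a → IsArchInnerTransfer L H' m' m a' a →
        ∀ (γ₀ : (cmDatum L 3 H').Rational) (γ : (cmDatum L 3 (Matrix.of fun i j : Fin 3 => if i.val + j.val + 1 = 3 then (1 : L) else 0)).Rational) (e₁ e₂ : L),
          Corresponds (cmConjRingHom L) H' (Matrix.of fun i j : Fin 3 => if i.val + j.val + 1 = 3 then (1 : L) else 0) (γ₀ : unitaryGroup (cmConjRingHom L) H') (γ : unitaryGroup (cmConjRingHom L) (Matrix.of fun i j : Fin 3 => if i.val + j.val + 1 = 3 then (1 : L) else 0)) →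
          e₁ ≠ e₂ →
          ((((γ₀ : unitaryGroup (cmConjRingHom L) H').val : GL (Fin 3) L) : Matrix (Fin 3) (Fin 3) L) - e₁ • (1 : Matrix (Fin 3) (Fin 3) L)) *
            ((((γ₀ : unitaryGroup (cmConjRingHom L) H').val : GL (Fin 3) L) : Matrix (Fin 3) (Fin 3) L) - e₂ • (1 : Matrix (Fin 3) (Fin 3) L)) = 0 →
          (¬ ∃ ζ : L, (((γ₀ : unitaryGroup (cmConjRingHom L) H').val : GL (Fin 3) L) : Matrix (Fin 3) (Fin 3) L) = ζ • (1 : Matrix (Fin 3) (Fin 3) L)) →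
          archStableOrbitalIntegral L 3 H' mGis (fun x => kottwitzSignArchWeight L 3 H' (ConjClasses.mk x) * a' x) (cmRationalToArch L 3 H' γ₀) =
            archStableOrbitalIntegral L 3 (Matrix.of fun i j : Fin 3 => if i.val + j.val + 1 = 3 then (1 : L) else 0) mqis
              (fun x => kottwitzSignArchWeight L 3 (Matrix.of fun i j : Fin 3 => if i.val + j.val + 1 = 3 then (1 : L) else 0) (ConjClasses.mk x) * a x) (cmRationalToArch L 3 (Matrix.of fun i j : Fin 3 => if i.val + j.val + 1 = 3 then (1 : L) else 0) γ)) ∧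
      -- (J-val-K-built): at every FRAMED guard point off the centre, the exported datum IS `K⁻¹ ×` the top-form centraliser measure (★ p843734's `hK`, ONE constant)
      (∀ x : arch (↥(maximalRealSubfield L)) L (IsCMField.complexConj L) 3 H', (∃ γ₀ : (cmDatum L 3 H').Rational, ¬ IsRegularElt (γ₀.val : GL (Fin 3) L) ∧
          Corresponds (conjMixed (↥(maximalRealSubfield L)) L (IsCMField.complexConj L)) (archFormOf L 3 H') (archFormOf L 3 H') (cmRationalToArch L 3 H' γ₀) x) →
        (¬ ∃ ζ : L, ((x : GL (Fin 3) (mixedSpace L)) : Matrix (Fin 3) (Fin 3) (mixedSpace L)) = mixedEmbedding L ζ • (1 : Matrix (Fin 3) (Fin 3) (mixedSpace L))) →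
        (∃ (a b : L) (Tm : GL (Fin 3) (mixedSpace L)) (H_a : Matrix (Fin 2) (Fin 2) L) (H_b : Matrix (Fin 1) (Fin 1) L), IsSingularArchFrame L H' x a b Tm H_a H_b) →
        TsG x = K⁻¹ • centralizerTopFormHaar L H' x) ∧
      -- (W-a): there, the built singular member IS `K ×` the top-form member
      (∀ x : arch (↥(maximalRealSubfield L)) L (IsCMField.complexConj L) 3 H', (∃ γ₀ : (cmDatum L 3 H').Rational, ¬ IsRegularElt (γ₀.val : GL (Fin 3) L) ∧
          Corresponds (conjMixed (↥(maximalRealSubfield L)) L (IsCMField.complexConj L)) (archFormOf L 3 H') (archFormOf L 3 H') (cmRationalToArch L 3 H' γ₀) x) →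
        (¬ ∃ ζ : L, ((x : GL (Fin 3) (mixedSpace L)) : Matrix (Fin 3) (Fin 3) (mixedSpace L)) = mixedEmbedding L ζ • (1 : Matrix (Fin 3) (Fin 3) (mixedSpace L))) →
        (∃ (a b : L) (Tm : GL (Fin 3) (mixedSpace L)) (H_a : Matrix (Fin 2) (Fin 2) L) (H_b : Matrix (Fin 1) (Fin 1) L), IsSingularArchFrame L H' x a b Tm H_a H_b) →
        ∃ (_ : (centralizerTopFormHaar L H' x).IsHaarMeasure) (_ : (centralizerTopFormHaar L H' x).IsInvInvariant),
          mGis.atPoint x = K • quotientMeasure (Subgroup.centralizer ({x} : Set (arch (↥(maximalRealSubfield L)) L (IsCMField.complexConj L) 3 H'))) (centralizerTopFormHaar L H' x) (isClosed_coe_centralizer_singleton x) ν' ∧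
          mGis.atPoint x = K • (archSingularTopFormFamily L H' ν').atPoint x) := by
  classical
  -- Borel σ-algebras on the auxiliary carriers (they do not occur in the statement)
  obtain ⟨iQA, iQAb⟩ : ∃ i : ∀ γ : arch (↥(maximalRealSubfield L)) L (IsCMField.complexConj L) 3 (Matrix.diagonal α'), MeasurableSpace (arch (↥(maximalRealSubfield L)) L (IsCMField.complexConj L) 3 (Matrix.diagonal α') ⧸ Subgroup.centralizer ({γ} : Set (arch (↥(maximalRealSubfield L)) L (IsCMField.complexConj L) 3 (Matrix.diagonal α')))),
      ∀ γ, @BorelSpace _ _ (i γ) := ⟨fun _ => borel _, fun _ => @BorelSpace.mk _ _ (borel _) rfl⟩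
  obtain ⟨iLA, iLAb⟩ : ∃ i : ∀ (v : {w : InfinitePlace L // IsComplex w}) (g : archLocal L 3 (Matrix.diagonal α') v), MeasurableSpace (archLocal L 3 (Matrix.diagonal α') v ⧸ Subgroup.centralizer ({g} : Set (archLocal L 3 (Matrix.diagonal α') v))),
      ∀ v g, @BorelSpace _ _ (i v g) := ⟨fun _ _ => borel _, fun _ _ => @BorelSpace.mk _ _ (borel _) rfl⟩
  obtain ⟨iAB, iABb⟩ : ∃ i : MeasurableSpace (arch (↥(maximalRealSubfield L)) L (IsCMField.complexConj L) 3 (Matrix.diagonal β)), @BorelSpace _ _ i := ⟨borel _, @BorelSpace.mk _ _ (borel _) rfl⟩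
  obtain ⟨iQB, iQBb⟩ : ∃ i : ∀ γ : arch (↥(maximalRealSubfield L)) L (IsCMField.complexConj L) 3 (Matrix.diagonal β), MeasurableSpace (arch (↥(maximalRealSubfield L)) L (IsCMField.complexConj L) 3 (Matrix.diagonal β) ⧸ Subgroup.centralizer ({γ} : Set (arch (↥(maximalRealSubfield L)) L (IsCMField.complexConj L) 3 (Matrix.diagonal β)))),
      ∀ γ, @BorelSpace _ _ (i γ) := ⟨fun _ => borel _, fun _ => @BorelSpace.mk _ _ (borel _) rfl⟩
  obtain ⟨iLB, iLBb⟩ : ∃ i : ∀ (v : {w : InfinitePlace L // IsComplex w}) (g : archLocal L 3 (Matrix.diagonal β) v), MeasurableSpace (archLocal L 3 (Matrix.diagonal β) v ⧸ Subgroup.centralizer ({g} : Set (archLocal L 3 (Matrix.diagonal β) v))),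
      ∀ v g, @BorelSpace _ _ (i v g) := ⟨fun _ _ => borel _, fun _ _ => @BorelSpace.mk _ _ (borel _) rfl⟩
  obtain ⟨iRB, iRBb⟩ : ∃ i : ∀ (v : {w : InfinitePlace L // IsComplex w}) (τ : Perm (Fin 3)), MeasurableSpace (archLocal L 3 (Matrix.diagonal (β ∘ ⇑τ)) v ⧸ Subgroup.centralizer
      ({(⟨circleDiagonal 3 (z₁ v), circleDiagonal_mem_archLocal_diagonal L 3 (β ∘ ⇑τ) v (z₁ v)⟩ : archLocal L 3 (Matrix.diagonal (β ∘ ⇑τ)) v)} : Set (archLocal L 3 (Matrix.diagonal (β ∘ ⇑τ)) v))),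
      ∀ v τ, @BorelSpace _ _ (i v τ) := ⟨fun _ _ => borel _, fun _ _ => @BorelSpace.mk _ _ (borel _) rfl⟩
  -- the reference-wall quotient σ-algebras of the carrier `α'` are PARAMETERS here ((U) is stated over them): re-introduce them as the most recent local instances, so that
  -- instance search finds them before trying (and expensively failing on) the auxiliary quotient σ-algebras above
  letI iRAl : ∀ (w : {w : InfinitePlace L // IsComplex w}) (τ : Perm (Fin 3)), MeasurableSpace (archLocal L 3 (Matrix.diagonal (α' ∘ ⇑τ)) w ⧸ Subgroup.centralizer ({(⟨circleDiagonal 3 (z₁ w), circleDiagonal_mem_archLocal_diagonal L 3 (α' ∘ ⇑τ) w (z₁ w)⟩ : archLocal L 3 (Matrix.diagonal (α' ∘ ⇑τ)) w)} : Set (archLocal L 3 (Matrix.diagonal (α' ∘ ⇑τ)) w))) := iRA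
  haveI iRAbl : ∀ (w : {w : InfinitePlace L // IsComplex w}) (τ : Perm (Fin 3)), BorelSpace (archLocal L 3 (Matrix.diagonal (α' ∘ ⇑τ)) w ⧸ Subgroup.centralizer ({(⟨circleDiagonal 3 (z₁ w), circleDiagonal_mem_archLocal_diagonal L 3 (α' ∘ ⇑τ) w (z₁ w)⟩ : archLocal L 3 (Matrix.diagonal (α' ∘ ⇑τ)) w)} : Set (archLocal L 3 (Matrix.diagonal (α' ∘ ⇑τ)) w))) := iRAb
  -- ===== carrier `U(diag α')`: congruence, product-Haar reading, reference pins, one-stop pins, the witness family =====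
  let Ψ : arch (↥(maximalRealSubfield L)) L (IsCMField.complexConj L) 3 H' ≃ₜ* arch (↥(maximalRealSubfield L)) L (IsCMField.complexConj L) 3 (Matrix.diagonal α') :=
    unitaryGroupOfFormCongrOfEq (conjMixed (↥(maximalRealSubfield L)) L (IsCMField.complexConj L)) (Matrix.GeneralLinearGroup.map (mixedEmbedding L) P)
      (archFormOf L 3 (Matrix.diagonal α')) (archFormOf L 3 H') (formCongr_map_mixedEmbedding_archFormOf_eq L hP)
  have hΨ : ∀ g : arch (↥(maximalRealSubfield L)) L (IsCMField.complexConj L) 3 H', ((Ψ g : arch (↥(maximalRealSubfield L)) L (IsCMField.complexConj L) 3 (Matrix.diagonal α')) : GL (Fin 3) (mixedSpace L)) =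
      Matrix.GeneralLinearGroup.map (mixedEmbedding L) P * (g : GL (Fin 3) (mixedSpace L)) * (Matrix.GeneralLinearGroup.map (mixedEmbedding L) P)⁻¹ := fun _ => rfl
  have hSA := formCongr_map_mixedEmbedding_archFormOf_eq L hP
  haveI : (ν'.map Ψ).IsHaarMeasure := ContinuousMulEquiv.isHaarMeasure_map ν' Ψ
  obtain ⟨νwA, hνwAH, hνA⟩ := exists_isHaarMeasure_eq_map_archPiEquivCM_symm_pi L 3 α' (ν'.map Ψ)
  have hνwA : ∀ v, (νwA v).IsHaarMeasure ∧ (νwA v).IsMulRightInvariant := fun v =>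
    ⟨hνwAH v, by haveI := hνwAH v; exact isMulRightInvariant_of_isHaarMeasure_archLocal_diagonal L α' hα' hhermα v (νwA v)⟩
  have hrealA : ∀ (w : {w : InfinitePlace L // IsComplex w}) (i : Fin 3), (w.1.embedding (α' i)).im = 0 := fun w => im_embedding_diagonal_eq_zero L 3 α' hhermα w
  obtain ⟨νHA, hνHA, hpinA, hT02A, hT01A⟩ := exists_pinned_reference_centralizer_family L α' hα' hrealA z₁ h02 h01 νwA hνwA
  obtain ⟨ρZA, ρPA, ρ'A, TA, hρZiA, hρZA, hρZ1A, hρPiA, hρPA, hρ'iA, hρ'A, hTA, -, hTiA, hcohA⟩ :=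
    exists_pins_conj_coherent_telescope_all L α' hα' hrealA z₁ h02 h01 νHA hνHA hT02A hT01A
      (κ := {z0 : {w : InfinitePlace L // IsComplex w} → Fin 3 → Circle // ∀ w, z0 w 0 = z0 w 2 ∧ z0 w 0 ≠ z0 w 1}) Subtype.val (fun k w => k.2 w) Subtype.val_injective
  haveI iHA : ((Measure.pi νwA).map (archPiEquivCM 3 L (Matrix.diagonal α')).symm).IsHaarMeasure := hνA ▸ inferInstance
  haveI iHAr : ((Measure.pi νwA).map (archPiEquivCM 3 L (Matrix.diagonal α')).symm).IsMulRightInvariant :=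
    hνA ▸ UnitaryGroup.isMulRightInvariant_map_continuousMulEquiv Ψ ν'
  obtain ⟨mGis, TsA, hQA, hinvA, hcenA, hpinWA, hpullA⟩ := exists_archSingularFamily_of_coherent_torusDatum_pullback L H' α' (Matrix.GeneralLinearGroup.map (mixedEmbedding L) P)
    Ψ hΨ hherm hanis hα' hhermα ν' ((Measure.pi νwA).map (archPiEquivCM 3 L (Matrix.diagonal α')).symm) hνA.symm TA hTiA hcohA
  -- ===== carrier `U(diag β)`: congruence, product-Haar reading, reference pins, one-stop pins, the witness family =====
  let Φ_A : arch (↥(maximalRealSubfield L)) L (IsCMField.complexConj L) 3 (Matrix.of fun i j : Fin 3 => if i.val + j.val + 1 = 3 then (1 : L) else 0) ≃ₜ* arch (↥(maximalRealSubfield L)) L (IsCMField.complexConj L) 3 (Matrix.diagonal β) :=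
    unitaryGroupOfFormCongrOfEq (conjMixed (↥(maximalRealSubfield L)) L (IsCMField.complexConj L)) (Matrix.GeneralLinearGroup.map (mixedEmbedding L) Q)
      (archFormOf L 3 (Matrix.diagonal β)) (archFormOf L 3 (Matrix.of fun i j : Fin 3 => if i.val + j.val + 1 = 3 then (1 : L) else 0)) (formCongr_map_mixedEmbedding_archFormOf_eq L hQ)
  have hΦ_A : ∀ g : arch (↥(maximalRealSubfield L)) L (IsCMField.complexConj L) 3 (Matrix.of fun i j : Fin 3 => if i.val + j.val + 1 = 3 then (1 : L) else 0), ((Φ_A g : arch (↥(maximalRealSubfield L)) L (IsCMField.complexConj L) 3 (Matrix.diagonal β)) : GL (Fin 3) (mixedSpace L)) =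
      Matrix.GeneralLinearGroup.map (mixedEmbedding L) Q * (g : GL (Fin 3) (mixedSpace L)) * (Matrix.GeneralLinearGroup.map (mixedEmbedding L) Q)⁻¹ := fun _ => rfl
  have hSB := formCongr_map_mixedEmbedding_archFormOf_eq L hQ
  haveI : (ν.map Φ_A).IsHaarMeasure := ContinuousMulEquiv.isHaarMeasure_map ν Φ_A
  obtain ⟨νwB, hνwBH, hνB⟩ := exists_isHaarMeasure_eq_map_archPiEquivCM_symm_pi L 3 β (ν.map Φ_A)
  have hνwB : ∀ v, (νwB v).IsHaarMeasure ∧ (νwB v).IsMulRightInvariant := fun v =>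
    ⟨hνwBH v, by haveI := hνwBH v; exact isMulRightInvariant_of_isHaarMeasure_archLocal_diagonal L β hβ hhermβ v (νwB v)⟩
  have hrealB : ∀ (w : {w : InfinitePlace L // IsComplex w}) (i : Fin 3), (w.1.embedding (β i)).im = 0 := fun w => im_embedding_diagonal_eq_zero L 3 β hhermβ w
  obtain ⟨νHB, hνHB, hpinB, hT02B, hT01B⟩ := exists_pinned_reference_centralizer_family L β hβ hrealB z₁ h02 h01 νwB hνwB
  obtain ⟨ρZB, ρPB, ρ'B, TB, hρZiB, hρZB, hρZ1B, hρPiB, hρPB, hρ'iB, hρ'B, hTB, -, hTiB, hcohB⟩ :=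
    exists_pins_conj_coherent_telescope_all L β hβ hrealB z₁ h02 h01 νHB hνHB hT02B hT01B
      (κ := {z0 : {w : InfinitePlace L // IsComplex w} → Fin 3 → Circle // ∀ w, z0 w 0 = z0 w 2 ∧ z0 w 0 ≠ z0 w 1}) Subtype.val (fun k w => k.2 w) Subtype.val_injective
  haveI iHB : ((Measure.pi νwB).map (archPiEquivCM 3 L (Matrix.diagonal β)).symm).IsHaarMeasure := hνB ▸ inferInstance
  haveI iHBr : ((Measure.pi νwB).map (archPiEquivCM 3 L (Matrix.diagonal β)).symm).IsMulRightInvariant :=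
    hνB ▸ UnitaryGroup.isMulRightInvariant_map_continuousMulEquiv Φ_A ν
  obtain ⟨mqis, TsB, hQB, hinvB, hcenB, hpinWB⟩ := exists_archSingularFamily_of_coherent_torusDatum L H' β (Matrix.GeneralLinearGroup.map (mixedEmbedding L) Q)
    Φ_A hΦ_A hherm hanis hβ hhermβ ν ((Measure.pi νwB).map (archPiEquivCM 3 L (Matrix.diagonal β)).symm) hνB.symm TB hTiB hcohB
  -- the relabelled product-Haar factors are Haar ∕ right invariant (fed to the END and to (U)'s pin clause)
  have hντiA : ∀ (v : {w : InfinitePlace L // IsComplex w}) (τ : Perm (Fin 3)),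
      ((νwA v).map (ContinuousMulEquiv.restrictSubgroup (GLn.conjEquiv (Matrix.GeneralLinearGroup.mkOfDetNeZero _ (det_monomial_one_ne_zero 3 τ)))
        (archLocal L 3 (Matrix.diagonal (α' ∘ ⇑τ)) v) (archLocal L 3 (Matrix.diagonal α') v) (mem_archLocal_comp_perm_iff_conj_mem L 3 α' v τ)).symm).IsHaarMeasure ∧
      ((νwA v).map (ContinuousMulEquiv.restrictSubgroup (GLn.conjEquiv (Matrix.GeneralLinearGroup.mkOfDetNeZero _ (det_monomial_one_ne_zero 3 τ)))
        (archLocal L 3 (Matrix.diagonal (α' ∘ ⇑τ)) v) (archLocal L 3 (Matrix.diagonal α') v) (mem_archLocal_comp_perm_iff_conj_mem L 3 α' v τ)).symm).IsMulRightInvariant := by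
    intro v τ
    haveI := (hνwA v).1; haveI := (hνwA v).2
    exact ⟨ContinuousMulEquiv.isHaarMeasure_map (νwA v) _, isMulRightInvariant_map_relabel_symm L 3 α' v τ (νwA v)⟩
  -- ===== (J-val-K-built): (U) at the rational-type wall torus point behind a framed guard point, carried to `Ψ x` (coherence) and to `x` ((PULL) + (b0)) =====
  have hpinU : ∀ (w : {w : InfinitePlace L // IsComplex w}) (τ : Perm (Fin 3)), (w.1.embedding (α' (τ 0))).re * (w.1.embedding (α' (τ 2))).re < 0 →
        haveI : LocallyCompactSpace (archLocal L 3 (Matrix.diagonal (α' ∘ ⇑τ)) w) := locallyCompactSpace_archLocal L 3 (Matrix.diagonal (α' ∘ ⇑τ)) w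
        haveI : SecondCountableTopology (archLocal L 3 (Matrix.diagonal (α' ∘ ⇑τ)) w) := secondCountableTopology_archLocal L 3 (Matrix.diagonal (α' ∘ ⇑τ)) w
        haveI : (νHA w τ).IsHaarMeasure := (hνHA w τ).1
        haveI : (νHA w τ).IsInvInvariant := (hνHA w τ).2
        ∃ (ν : Measure (archLocal L 3 (Matrix.diagonal (α' ∘ ⇑τ)) w)) (_ : ν.IsHaarMeasure) (_ : ν.IsMulRightInvariant),
          ∀ (Θ : Matrix (Fin 3) (Fin 3) ℂ → ℂ), ContDiff ℝ (⊤ : ℕ∞) Θ →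
            HasCompactSupport (fun k : archLocal L 3 (Matrix.diagonal (α' ∘ ⇑τ)) w => Θ ((k : GL (Fin 3) ℂ) : Matrix (Fin 3) (Fin 3) ℂ)) →
            ∀ (z₀ : Fin 3 → Circle) (h02' : z₀ 0 = z₀ 2) (h01' : z₀ 0 ≠ z₀ 1),
              Tendsto (fun ψ : ℝ => deriv (fun ψ : ℝ => (2 * Real.sin ψ : ℂ) *
                  ∫ g, Θ (((g * ⟨circleDiagonal 3 (fun i => z₀ i * Circle.exp (![(1 : ℝ), 0, -1] i * ψ)),
                    circleDiagonal_mem_archLocal_diagonal L 3 (α' ∘ ⇑τ) w _⟩ * g⁻¹ : archLocal L 3 (Matrix.diagonal (α' ∘ ⇑τ)) w) : GL (Fin 3) ℂ) : Matrix (Fin 3) (Fin 3) ℂ) ∂(ν)) ψ)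
                (𝓝[≠] 0)
                (𝓝 ((-1 : ℂ) * ∫ y, descConj (⟨circleDiagonal 3 z₀, circleDiagonal_mem_archLocal_diagonal L 3 (α' ∘ ⇑τ) w z₀⟩ : archLocal L 3 (Matrix.diagonal (α' ∘ ⇑τ)) w)
                  (Subgroup.centralizer ({(⟨circleDiagonal 3 (z₁ w), circleDiagonal_mem_archLocal_diagonal L 3 (α' ∘ ⇑τ) w (z₁ w)⟩ : archLocal L 3 (Matrix.diagonal (α' ∘ ⇑τ)) w)} : Set (archLocal L 3 (Matrix.diagonal (α' ∘ ⇑τ)) w)))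
                  (forall_mem_centralizer_circleDiagonal_comm_of_wall L (α' ∘ ⇑τ) w (h02 w) (h01 w) h02' h01')
                  (fun k : archLocal L 3 (Matrix.diagonal (α' ∘ ⇑τ)) w => Θ ((k : GL (Fin 3) ℂ) : Matrix (Fin 3) (Fin 3) ℂ)) y
                  ∂(quotientMeasure _ (νHA w τ) (isClosed_coe_centralizer_singleton _) (ν)))) := fun w τ hτ =>
    ⟨_, (hντiA w τ).1, (hντiA w τ).2, hpinA w τ hτ⟩
  have hJ : ∀ x : arch (↥(maximalRealSubfield L)) L (IsCMField.complexConj L) 3 H', (∃ γ₀ : (cmDatum L 3 H').Rational, ¬ IsRegularElt (γ₀.val : GL (Fin 3) L) ∧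
          Corresponds (conjMixed (↥(maximalRealSubfield L)) L (IsCMField.complexConj L)) (archFormOf L 3 H') (archFormOf L 3 H') (cmRationalToArch L 3 H' γ₀) x) →
        (¬ ∃ ζ : L, ((x : GL (Fin 3) (mixedSpace L)) : Matrix (Fin 3) (Fin 3) (mixedSpace L)) = mixedEmbedding L ζ • (1 : Matrix (Fin 3) (Fin 3) (mixedSpace L))) →
        (∃ (a b : L) (Tm : GL (Fin 3) (mixedSpace L)) (H_a : Matrix (Fin 2) (Fin 2) L) (H_b : Matrix (Fin 1) (Fin 1) L), IsSingularArchFrame L H' x a b Tm H_a H_b) →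
        TsA x = K⁻¹ • centralizerTopFormHaar L H' x := by
    intro x hx hnc hfr
    -- the guard point is `Ψ`-conjugate to a RATIONAL-TYPE wall torus point (★ (W4c′))
    obtain ⟨zw, hw, hrat, ρ, q, hq⟩ := exists_conj_archDiagTorus_eq_archCongr_of_not_central L H' α' (Matrix.GeneralLinearGroup.map (mixedEmbedding L) P) Ψ hΨ hherm hanis hα' hhermα hx hnc
    have hq' : (MulAut.conj q : arch (↥(maximalRealSubfield L)) L (IsCMField.complexConj L) 3 (Matrix.diagonal α') ≃* arch (↥(maximalRealSubfield L)) L (IsCMField.complexConj L) 3 (Matrix.diagonal α')) (archDiagTorus L 3 α' fun w => zw w ∘ ⇑(ρ w)) = Ψ x := hq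
    -- frames: at `Ψ x` by ★ (b0), at the torus point by conjugation
    have hfrΨ : ∃ (a b : L) (Tm : GL (Fin 3) (mixedSpace L)) (H_a : Matrix (Fin 2) (Fin 2) L) (H_b : Matrix (Fin 1) (Fin 1) L), IsSingularArchFrame L (Matrix.diagonal α') (Ψ x) a b Tm H_a H_b :=
      exists_isSingularArchFrame_archCongr (Matrix.GeneralLinearGroup.map (mixedEmbedding L) P) hSA x hfr
    have hfrt : ∃ (a b : L) (Tm : GL (Fin 3) (mixedSpace L)) (H_a : Matrix (Fin 2) (Fin 2) L) (H_b : Matrix (Fin 1) (Fin 1) L),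
        IsSingularArchFrame L (Matrix.diagonal α') (archDiagTorus L 3 α' fun w => zw w ∘ ⇑(ρ w)) a b Tm H_a H_b := by
      have e : archDiagTorus L 3 α' (fun w => zw w ∘ ⇑(ρ w)) = q⁻¹ * Ψ x * q⁻¹⁻¹ := by
        rw [inv_inv, ← hq', MulAut.conj_apply]; group
      rw [e]
      exact exists_isSingularArchFrame_conj _ _ hfrΨ
    -- (U) at the torus point, and the one-stop's `T (t) = ρ′`
    have hUt : centralizerTopFormHaar L (Matrix.diagonal α') (archDiagTorus L 3 α' fun w => zw w ∘ ⇑(ρ w)) = K • ρ'A ⟨zw, hw⟩ ρ :=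
      hU νHA hνHA hpinU zw hw hrat ρ (ρZA ⟨zw, hw⟩) (hρZiA ⟨zw, hw⟩) (hρZA ⟨zw, hw⟩) (hρZ1A ⟨zw, hw⟩) (ρPA ⟨zw, hw⟩ ρ) (hρPA ⟨zw, hw⟩ ρ) (ρ'A ⟨zw, hw⟩ ρ) (hρ'A ⟨zw, hw⟩ ρ)
    have hTt : TA (archDiagTorus L 3 α' fun w => zw w ∘ ⇑(ρ w)) = K⁻¹ • centralizerTopFormHaar L (Matrix.diagonal α') (archDiagTorus L 3 α' fun w => zw w ∘ ⇑(ρ w)) := by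
      have h1 : TA (archDiagTorus L 3 α' fun w => zw w ∘ ⇑(ρ w)) = ρ'A ⟨zw, hw⟩ ρ := hTA ⟨zw, hw⟩ ρ
      rw [h1, hUt, smul_smul, inv_mul_cancel₀ hK, one_smul]
    -- carried along the conjugator `q` (the one-stop's coherence; the top-form side by ★ `map_subgroupCongrHomeomorph_conj_centralizerTopFormHaar`)
    have hTΨ : TA (Ψ x) = K⁻¹ • centralizerTopFormHaar L (Matrix.diagonal α') (Ψ x) := by
      rw [← hcohA _ (Ψ x) q hq' ⟨⟨zw, hw⟩, ρ, 1, by simp⟩, hTt, Measure.map_smul, map_subgroupCongrHomeomorph_conj_centralizerTopFormHaar q hq' hfrt]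
    -- pulled back along `Ψ` ((PULL)), against ★ (b0) pushed forward along `Ψ`: `Ψ⁻¹| ∘ Ψ| = id`
    have hb0 : Measure.map (subgroupCongrHomeomorph (Ψ.toMulEquiv : arch (↥(maximalRealSubfield L)) L (IsCMField.complexConj L) 3 H' ≃* arch (↥(maximalRealSubfield L)) L (IsCMField.complexConj L) 3 (Matrix.diagonal α'))
        (Subgroup.centralizer ({x} : Set (arch (↥(maximalRealSubfield L)) L (IsCMField.complexConj L) 3 H'))) (Subgroup.centralizer ({Ψ x} : Set (arch (↥(maximalRealSubfield L)) L (IsCMField.complexConj L) 3 (Matrix.diagonal α'))))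
        (forall_apply_mem_centralizer_singleton_iff_of_eq (Ψ.toMulEquiv : arch (↥(maximalRealSubfield L)) L (IsCMField.complexConj L) 3 H' ≃* arch (↥(maximalRealSubfield L)) L (IsCMField.complexConj L) 3 (Matrix.diagonal α')) rfl) Ψ.continuous Ψ.symm.continuous)
        (centralizerTopFormHaar L H' x) = centralizerTopFormHaar L (Matrix.diagonal α') (Ψ x) :=
      map_archCongr_centralizerTopFormHaar (Matrix.GeneralLinearGroup.map (mixedEmbedding L) P) hSA hfr
    rw [hpullA x ⟨⟨zw, hw⟩, ρ, q, hq'⟩, hTΨ, Measure.map_smul, ← hb0,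
      map_subgroupCongrHomeomorph_map_subgroupCongrHomeomorph (Ψ.toMulEquiv : arch (↥(maximalRealSubfield L)) L (IsCMField.complexConj L) 3 H' ≃* arch (↥(maximalRealSubfield L)) L (IsCMField.complexConj L) 3 (Matrix.diagonal α')) (Ψ.toMulEquiv.symm : arch (↥(maximalRealSubfield L)) L (IsCMField.complexConj L) 3 (Matrix.diagonal α') ≃* arch (↥(maximalRealSubfield L)) L (IsCMField.complexConj L) 3 H') (MulEquiv.refl (arch (↥(maximalRealSubfield L)) L (IsCMField.complexConj L) 3 H'))
        (fun y => Ψ.toMulEquiv.symm_apply_apply y) _ _ (Subgroup.centralizer ({x} : Set (arch (↥(maximalRealSubfield L)) L (IsCMField.complexConj L) 3 H'))) _ _ (fun _ => Iff.rfl) _ _ _ _ continuous_id continuous_id]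
    have hid : (⇑(subgroupCongrHomeomorph (MulEquiv.refl (arch (↥(maximalRealSubfield L)) L (IsCMField.complexConj L) 3 H')) (Subgroup.centralizer ({x} : Set (arch (↥(maximalRealSubfield L)) L (IsCMField.complexConj L) 3 H'))) (Subgroup.centralizer ({x} : Set (arch (↥(maximalRealSubfield L)) L (IsCMField.complexConj L) 3 H'))) (fun _ => Iff.rfl)
        continuous_id continuous_id) : Subgroup.centralizer ({x} : Set (arch (↥(maximalRealSubfield L)) L (IsCMField.complexConj L) 3 H')) → Subgroup.centralizer ({x} : Set (arch (↥(maximalRealSubfield L)) L (IsCMField.complexConj L) 3 H'))) = id :=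
      funext fun y => Subtype.ext rfl
    rw [hid, Measure.map_id]
  -- ===== (W-a): ★ p843734 §1 on the conjugation-stable framed guard off the centre; coherence of `TsA` there = coherence of the top-form measure =====
  have hWa : ∀ x : arch (↥(maximalRealSubfield L)) L (IsCMField.complexConj L) 3 H', (∃ γ₀ : (cmDatum L 3 H').Rational, ¬ IsRegularElt (γ₀.val : GL (Fin 3) L) ∧
          Corresponds (conjMixed (↥(maximalRealSubfield L)) L (IsCMField.complexConj L)) (archFormOf L 3 H') (archFormOf L 3 H') (cmRationalToArch L 3 H' γ₀) x) →
        (¬ ∃ ζ : L, ((x : GL (Fin 3) (mixedSpace L)) : Matrix (Fin 3) (Fin 3) (mixedSpace L)) = mixedEmbedding L ζ • (1 : Matrix (Fin 3) (Fin 3) (mixedSpace L))) →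
        (∃ (a b : L) (Tm : GL (Fin 3) (mixedSpace L)) (H_a : Matrix (Fin 2) (Fin 2) L) (H_b : Matrix (Fin 1) (Fin 1) L), IsSingularArchFrame L H' x a b Tm H_a H_b) →
        ∃ (_ : (centralizerTopFormHaar L H' x).IsHaarMeasure) (_ : (centralizerTopFormHaar L H' x).IsInvInvariant),
          mGis.atPoint x = K • quotientMeasure (Subgroup.centralizer ({x} : Set (arch (↥(maximalRealSubfield L)) L (IsCMField.complexConj L) 3 H'))) (centralizerTopFormHaar L H' x) (isClosed_coe_centralizer_singleton x) ν' ∧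
          mGis.atPoint x = K • (archSingularTopFormFamily L H' ν').atPoint x := by
    intro x hx hnc hfr
    -- the framed guard off the centre is conjugation-stable (stated along `MulAut.conj q γ₁ = γ₂`, read at the target point: no rewriting of the guard's body)
    have hP' : ∀ (γ₁ γ₂ q : arch (↥(maximalRealSubfield L)) L (IsCMField.complexConj L) 3 H'), (MulAut.conj q : arch (↥(maximalRealSubfield L)) L (IsCMField.complexConj L) 3 H' ≃* arch (↥(maximalRealSubfield L)) L (IsCMField.complexConj L) 3 H') γ₁ = γ₂ →
        ((∃ γ₀ : (cmDatum L 3 H').Rational, ¬ IsRegularElt (γ₀.val : GL (Fin 3) L) ∧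
          Corresponds (conjMixed (↥(maximalRealSubfield L)) L (IsCMField.complexConj L)) (archFormOf L 3 H') (archFormOf L 3 H') (cmRationalToArch L 3 H' γ₀) γ₁) ∧
          (¬ ∃ ζ : L, ((γ₁ : GL (Fin 3) (mixedSpace L)) : Matrix (Fin 3) (Fin 3) (mixedSpace L)) = mixedEmbedding L ζ • (1 : Matrix (Fin 3) (Fin 3) (mixedSpace L))) ∧
          (∃ (a b : L) (Tm : GL (Fin 3) (mixedSpace L)) (H_a : Matrix (Fin 2) (Fin 2) L) (H_b : Matrix (Fin 1) (Fin 1) L), IsSingularArchFrame L H' γ₁ a b Tm H_a H_b)) →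
        ((∃ γ₀ : (cmDatum L 3 H').Rational, ¬ IsRegularElt (γ₀.val : GL (Fin 3) L) ∧
          Corresponds (conjMixed (↥(maximalRealSubfield L)) L (IsCMField.complexConj L)) (archFormOf L 3 H') (archFormOf L 3 H') (cmRationalToArch L 3 H' γ₀) γ₂) ∧
          (¬ ∃ ζ : L, ((γ₂ : GL (Fin 3) (mixedSpace L)) : Matrix (Fin 3) (Fin 3) (mixedSpace L)) = mixedEmbedding L ζ • (1 : Matrix (Fin 3) (Fin 3) (mixedSpace L))) ∧
          (∃ (a b : L) (Tm : GL (Fin 3) (mixedSpace L)) (H_a : Matrix (Fin 2) (Fin 2) L) (H_b : Matrix (Fin 1) (Fin 1) L), IsSingularArchFrame L H' γ₂ a b Tm H_a H_b)) := by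
      rintro γ₁ γ₂ q hq ⟨⟨γ₀, hnreg, hcorr⟩, hnc₁, hfr₁⟩
      have hqv : ((q : arch (↥(maximalRealSubfield L)) L (IsCMField.complexConj L) 3 H') : GL (Fin 3) (mixedSpace L)) * ((γ₁ : arch (↥(maximalRealSubfield L)) L (IsCMField.complexConj L) 3 H') : GL (Fin 3) (mixedSpace L)) * ((q : arch (↥(maximalRealSubfield L)) L (IsCMField.complexConj L) 3 H') : GL (Fin 3) (mixedSpace L))⁻¹ = ((γ₂ : arch (↥(maximalRealSubfield L)) L (IsCMField.complexConj L) 3 H') : GL (Fin 3) (mixedSpace L)) := by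
        rw [← hq]; rfl
      refine ⟨⟨γ₀, hnreg, hcorr.trans (isConj_iff.2 ⟨((q : arch (↥(maximalRealSubfield L)) L (IsCMField.complexConj L) 3 H') : GL (Fin 3) (mixedSpace L)), hqv⟩)⟩, ?_, ?_⟩
      · rintro ⟨ζ, hζ⟩
        refine hnc₁ ⟨ζ, ?_⟩
        have e1 : ((γ₁ : arch (↥(maximalRealSubfield L)) L (IsCMField.complexConj L) 3 H') : GL (Fin 3) (mixedSpace L)) = ((q : arch (↥(maximalRealSubfield L)) L (IsCMField.complexConj L) 3 H') : GL (Fin 3) (mixedSpace L))⁻¹ * ((γ₂ : arch (↥(maximalRealSubfield L)) L (IsCMField.complexConj L) 3 H') : GL (Fin 3) (mixedSpace L)) * ((q : arch (↥(maximalRealSubfield L)) L (IsCMField.complexConj L) 3 H') : GL (Fin 3) (mixedSpace L)) := by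
          rw [← hqv]; group
        rw [e1, commute_of_coe_eq_smul_one hζ ((q : arch (↥(maximalRealSubfield L)) L (IsCMField.complexConj L) 3 H') : GL (Fin 3) (mixedSpace L))⁻¹, inv_mul_cancel_right, hζ]
      · rw [← hq, MulAut.conj_apply]
        exact exists_isSingularArchFrame_conj γ₁ q hfr₁
    have hP : ∀ (γ₁ q : arch (↥(maximalRealSubfield L)) L (IsCMField.complexConj L) 3 H'), ((∃ γ₀ : (cmDatum L 3 H').Rational, ¬ IsRegularElt (γ₀.val : GL (Fin 3) L) ∧
          Corresponds (conjMixed (↥(maximalRealSubfield L)) L (IsCMField.complexConj L)) (archFormOf L 3 H') (archFormOf L 3 H') (cmRationalToArch L 3 H' γ₀) γ₁) ∧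
          (¬ ∃ ζ : L, ((γ₁ : GL (Fin 3) (mixedSpace L)) : Matrix (Fin 3) (Fin 3) (mixedSpace L)) = mixedEmbedding L ζ • (1 : Matrix (Fin 3) (Fin 3) (mixedSpace L))) ∧
          (∃ (a b : L) (Tm : GL (Fin 3) (mixedSpace L)) (H_a : Matrix (Fin 2) (Fin 2) L) (H_b : Matrix (Fin 1) (Fin 1) L), IsSingularArchFrame L H' γ₁ a b Tm H_a H_b)) →
        ((∃ γ₀ : (cmDatum L 3 H').Rational, ¬ IsRegularElt (γ₀.val : GL (Fin 3) L) ∧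
          Corresponds (conjMixed (↥(maximalRealSubfield L)) L (IsCMField.complexConj L)) (archFormOf L 3 H') (archFormOf L 3 H') (cmRationalToArch L 3 H' γ₀) (q * γ₁ * q⁻¹)) ∧
          (¬ ∃ ζ : L, (((q * γ₁ * q⁻¹) : GL (Fin 3) (mixedSpace L)) : Matrix (Fin 3) (Fin 3) (mixedSpace L)) = mixedEmbedding L ζ • (1 : Matrix (Fin 3) (Fin 3) (mixedSpace L))) ∧
          (∃ (a b : L) (Tm : GL (Fin 3) (mixedSpace L)) (H_a : Matrix (Fin 2) (Fin 2) L) (H_b : Matrix (Fin 1) (Fin 1) L), IsSingularArchFrame L H' (q * γ₁ * q⁻¹) a b Tm H_a H_b)) := fun γ₁ q h => hP' γ₁ (q * γ₁ * q⁻¹) q rfl h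
    have hcoh : ∀ (γ₁ γ₂ q : arch (↥(maximalRealSubfield L)) L (IsCMField.complexConj L) 3 H') (hq : (MulAut.conj q : arch (↥(maximalRealSubfield L)) L (IsCMField.complexConj L) 3 H' ≃* arch (↥(maximalRealSubfield L)) L (IsCMField.complexConj L) 3 H') γ₁ = γ₂),
        ((∃ γ₀ : (cmDatum L 3 H').Rational, ¬ IsRegularElt (γ₀.val : GL (Fin 3) L) ∧
          Corresponds (conjMixed (↥(maximalRealSubfield L)) L (IsCMField.complexConj L)) (archFormOf L 3 H') (archFormOf L 3 H') (cmRationalToArch L 3 H' γ₀) γ₁) ∧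
          (¬ ∃ ζ : L, ((γ₁ : GL (Fin 3) (mixedSpace L)) : Matrix (Fin 3) (Fin 3) (mixedSpace L)) = mixedEmbedding L ζ • (1 : Matrix (Fin 3) (Fin 3) (mixedSpace L))) ∧
          (∃ (a b : L) (Tm : GL (Fin 3) (mixedSpace L)) (H_a : Matrix (Fin 2) (Fin 2) L) (H_b : Matrix (Fin 1) (Fin 1) L), IsSingularArchFrame L H' γ₁ a b Tm H_a H_b)) →
        Measure.map (subgroupCongrHomeomorph (MulAut.conj q : arch (↥(maximalRealSubfield L)) L (IsCMField.complexConj L) 3 H' ≃* arch (↥(maximalRealSubfield L)) L (IsCMField.complexConj L) 3 H') (Subgroup.centralizer ({γ₁} : Set (arch (↥(maximalRealSubfield L)) L (IsCMField.complexConj L) 3 H'))) (Subgroup.centralizer ({γ₂} : Set (arch (↥(maximalRealSubfield L)) L (IsCMField.complexConj L) 3 H')))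
          (forall_apply_mem_centralizer_singleton_iff_of_eq (MulAut.conj q : arch (↥(maximalRealSubfield L)) L (IsCMField.complexConj L) 3 H' ≃* arch (↥(maximalRealSubfield L)) L (IsCMField.complexConj L) 3 H') hq) (continuous_mulAutConj q) (continuous_mulAutConj_symm q)) (TsA γ₁) = TsA γ₂ := by
      intro γ₁ γ₂ q hq h₁
      have h₂ := hP' γ₁ γ₂ q hq h₁
      rw [hJ γ₁ h₁.1 h₁.2.1 h₁.2.2, hJ γ₂ h₂.1 h₂.2.1 h₂.2.2, Measure.map_smul, map_subgroupCongrHomeomorph_conj_centralizerTopFormHaar q hq h₁.2.2]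
    have ht' : ∀ γ : arch (↥(maximalRealSubfield L)) L (IsCMField.complexConj L) 3 H', ((∃ γ₀ : (cmDatum L 3 H').Rational, ¬ IsRegularElt (γ₀.val : GL (Fin 3) L) ∧
          Corresponds (conjMixed (↥(maximalRealSubfield L)) L (IsCMField.complexConj L)) (archFormOf L 3 H') (archFormOf L 3 H') (cmRationalToArch L 3 H' γ₀) γ) ∧
          (¬ ∃ ζ : L, ((γ : GL (Fin 3) (mixedSpace L)) : Matrix (Fin 3) (Fin 3) (mixedSpace L)) = mixedEmbedding L ζ • (1 : Matrix (Fin 3) (Fin 3) (mixedSpace L))) ∧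
          (∃ (a b : L) (Tm : GL (Fin 3) (mixedSpace L)) (H_a : Matrix (Fin 2) (Fin 2) L) (H_b : Matrix (Fin 1) (Fin 1) L), IsSingularArchFrame L H' γ a b Tm H_a H_b)) →
        (centralizerTopFormHaar L H' γ).IsHaarMeasure ∧ (centralizerTopFormHaar L H' γ).IsInvInvariant := fun γ hγ => by
      obtain ⟨a, b, Tm, H_a, H_b, hf⟩ := hγ.2.2
      exact ⟨isHaarMeasure_centralizerTopFormHaar hf, isInvInvariant_centralizerTopFormHaar hf⟩
    have h1 := (hQA.mono fun γ hγ => hγ.1).atPoint_eq_inv_smul_quotientMeasure_of_eq_smul hP hcoh K⁻¹ (inv_ne_zero hK)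
      (fun γ hγ => hJ γ hγ.1 hγ.2.1 hγ.2.2) ht' x ⟨hx, hnc, hfr⟩
    rw [inv_inv] at h1
    obtain ⟨i1, i2, h2⟩ := exists_atPoint_archSingularTopFormFamily_eq L H' ν' x hfr
    refine ⟨(ht' x ⟨hx, hnc, hfr⟩).1, (ht' x ⟨hx, hnc, hfr⟩).2, h1, ?_⟩
    rw [h1, h2]
  -- ===== (ST-∞-s) by ★ p843392; (Q-∞)(Q-q∞) and the central masses from ★ p843611 =====
  refine ⟨mGis, mqis, TsA, TsB, hQA, hQB, hinvA, hinvB, fun c hc => ?_, fun c hc => ?_, ?_, hJ, hWa⟩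
  · obtain ⟨ζ, hζ⟩ := hc
    rw [archPart_cmDatum_toAdelic]
    exact hcenA (Quotient.out c) ζ hζ
  · obtain ⟨ζ, hζ⟩ := hc
    rw [archPart_cmDatum_toAdelic]
    exact hcenB (Quotient.out c) ζ hζ
  · -- ★ p843392, applied in stages (carrier α′ data, carrier β data, families, pins)
    have h1a := archStableOrbitalIntegral_signed_eq_of_isArchInnerTransfer_of_pinned L H' α' β
      (iGL := iGL) (iGLb := iGLb) (iAH := iAH) (iAHb := iAHb) (iAG := iAG) (iAGb := iAGb) (iQH := iQH) (iQHb := iQHb) (iQG := iQG) (iQGb := iQGb)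
      (iAα := iAA) (iAαb := iAAb) (iAβ := iAB) (iAβb := iABb) (iQα := iQA) (iQαb := iQAb) (iQβ := iQB) (iQβb := iQBb)
      (iLα := iLA) (iLαb := iLAb) (iLβ := iLB) (iLβb := iLBb) (iRα := iRAl) (iRαb := iRAbl) (iRβ := iRB) (iRβb := iRBb)
      hherm hanis ν' ν t' t hd' hd₃ hC hC'G m' m hW' hW
    have h1b := h1a hα' hhermα hβ hhermβ (Matrix.GeneralLinearGroup.map (mixedEmbedding L) P) Ψ hΨ hSA (Matrix.GeneralLinearGroup.map (mixedEmbedding L) Q) Φ_A hΦ_A hSB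
    have h1c := h1b νwA hνwA hνA νwB hνwB hνB h02 h01   -- (`z₁` was fixed by the named instance arguments)
    have h1d := h1c νHA hνHA
    have h1e := h1d
      (fun v τ => (νwA v).map (ContinuousMulEquiv.restrictSubgroup (GLn.conjEquiv (Matrix.GeneralLinearGroup.mkOfDetNeZero _ (det_monomial_one_ne_zero 3 τ)))
        (archLocal L 3 (Matrix.diagonal (α' ∘ ⇑τ)) v) (archLocal L 3 (Matrix.diagonal α') v) (mem_archLocal_comp_perm_iff_conj_mem L 3 α' v τ)).symm)
    have h1f := h1e hντiA rfl (fun _ _ => (-1 : ℂ))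
    have h1 := h1f hpinA (fun _ _ _ => rfl)
    have h2 := h1 νHB hνHB
      (fun v τ => (νwB v).map (ContinuousMulEquiv.restrictSubgroup (GLn.conjEquiv (Matrix.GeneralLinearGroup.mkOfDetNeZero _ (det_monomial_one_ne_zero 3 τ)))
        (archLocal L 3 (Matrix.diagonal (β ∘ ⇑τ)) v) (archLocal L 3 (Matrix.diagonal β) v) (mem_archLocal_comp_perm_iff_conj_mem L 3 β v τ)).symm)
      (fun v τ => by
        haveI := (hνwB v).1; haveI := (hνwB v).2
        exact ⟨ContinuousMulEquiv.isHaarMeasure_map (νwB v) _, isMulRightInvariant_map_relabel_symm L 3 β v τ (νwB v)⟩)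
      rfl (fun _ _ => -1)
    have h3 := h2 hpinB (fun _ _ _ => rfl) mGis hinvA mqis hinvB
    -- ★ p843392's per-wall-point packages `hpinα`, `hpinβ`: the one-stop pins at `k := ⟨z0, hwall⟩ + ★ p843611's (PIN) clause read through `T (t(z0∘ρ)) = ρ′ k ρ`
    refine h3 ?_ ?_
    · intro z0 hwall
      refine ⟨ρZA ⟨z0, hwall⟩, hρZiA ⟨z0, hwall⟩, ρPA ⟨z0, hwall⟩, hρPiA ⟨z0, hwall⟩, ρ'A ⟨z0, hwall⟩, hρ'iA ⟨z0, hwall⟩, hρZA ⟨z0, hwall⟩, fun v σ h => ?_,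
        hρPA ⟨z0, hwall⟩, hρ'A ⟨z0, hwall⟩, fun ρ => ?_⟩
      · rw [hρZ1A ⟨z0, hwall⟩ v σ h]; simp
      · obtain ⟨h1, h2, hq⟩ := hpinWA z0 hwall ρ
        haveI := (hρ'iA ⟨z0, hwall⟩ ρ).1; haveI := (hρ'iA ⟨z0, hwall⟩ ρ).2
        exact hq.trans (quotientMeasure_congr_measure _ _ _ _ (hTA ⟨z0, hwall⟩ ρ) _)
    · intro z0 hwall
      refine ⟨ρZB ⟨z0, hwall⟩, hρZiB ⟨z0, hwall⟩, ρPB ⟨z0, hwall⟩, hρPiB ⟨z0, hwall⟩, ρ'B ⟨z0, hwall⟩, hρ'iB ⟨z0, hwall⟩, hρZB ⟨z0, hwall⟩, fun v σ h => ?_,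
        hρPB ⟨z0, hwall⟩, hρ'B ⟨z0, hwall⟩, fun ρ => ?_⟩
      · rw [hρZ1B ⟨z0, hwall⟩ v σ h]; simp
      · obtain ⟨h1, h2, hq⟩ := hpinWB z0 hwall ρ
        haveI := (hρ'iB ⟨z0, hwall⟩ ρ).1; haveI := (hρ'iB ⟨z0, hwall⟩ ρ).2
        exact hq.trans (quotientMeasure_congr_measure _ _ _ _ (hTB ⟨z0, hwall⟩ ρ) _)

end Literature.NumberTheory.Rogawski1990

end
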